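import Mathlib
import Summits.ValiantsHypothesis.ValiantsHypothesis.Theorems.BarrierLeverPartitionMinorsHitByVPHiddenStatesSymbolicStep

/-!
# Route BarrierLever — item `PartitionMinorsHitByVP` (stmt-ValiantsHypothesis-19717), line `hidden_states`:
# THE u-OBLIVIOUS CUT GAME — a winning splitting invariant for the COLUMNS alone certifies a design against EVERY lower row family

Helper file (`--supports stmt-ValiantsHypothesis-19717`; cell valiant-natproofs, rung V4, 𝒟-side door (c), line
`Cruxes/PartitionMinorsHitByVP/Lines/hidden_states.lean` v8 (stubs `stub_afitLower`, `stub_pairJoinWideLower`, `stub_simplexPairLower`);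
prover seat val-np-p3 gen 13). Definition-free. Closes NO item.

THE POINT. The symbolic split theorem (`SymbJoin.symGood_of_split_enum`, val-np-p3 g10) certifies a join configuration `(u, e)` from its
DELETION and LINK sub-configurations at a coordinate `x`; the cut is chosen on the COLUMN side (cut constants `β, γ`), the row side is forced
(rows avoiding / containing `x`). For a LOWER row family `u` (the only case the crux needs,
`DownCompression`) three counting facts hold at every coordinate: link size ≤ deletion size (link ⊆ deletion), deletion size `≤ 2^(#coordinates − 1)`,
and SOME coordinate has link size `≥ ⌈(r−1)/#coordinates⌉` (double counting). Hence («cut game», `symGood_of_winning`): if a predicate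
`W hd r e` on column data alone («the position `e` is winning with `hd` coordinates to go») is such that every winning position with `r ≥ 2`
answers EVERY demand `(r₀, r₁)` in the NEED RANGE `r₀ + r₁ = r`, `lam hd r ≤ r₁ ≤ r₀ ≤ 2^(hd−1)` by a cut whose two sides are winning with
`hd − 1` coordinates — where `lam` is any certified lower bound for the best link size of lower families — then EVERY winning position is
generically good against EVERY injective lower row family on `≤ hd` coordinates: `symDet u e ≠ 0`, hence `∃ table` (`exists_table_of_winning`).
The row family never enters the game: proving a design universal for down-sets becomes pure column ARITHMETIC (for simplex-product designs:
which one-slot value splits of the pieces hit a demanded size — the «box-splitting game» of memo val-np-p3 g13, census kit j311880).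
`exists_link_ge` certifies the bound `lam hd r = ⌊(r−2)/hd⌋ + 1 = ⌈(r−1)/hd⌉`.

WHAT THIS IS NOT: no winning predicate is exhibited here (that is the open arithmetic); item 19717 stays OPEN; nothing on crux 14610 or VP ≠ VNP.
-/

set_option linter.dupNamespace false

namespace Summit.ValiantsHypothesis.ValiantsHypothesis.Theorems.BarrierLever.HiddenStates

open Finset Matrix MvPolynomial

noncomputable section

namespace SymbJoin

variable {h m K r : ℕ}

/-! ## 1. Deletion and link sizes of a row family at a coordinate -/

/-! Throughout, the LINK SIZE of a coordinate `x` in the row family `u` is `(Finset.univ.filter fun i => x ∈ u i).card` (rows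
containing `x`) and its DELETION SIZE is `(Finset.univ.filter fun i => x ∉ u i).card` (rows avoiding `x`); no abbreviations are
introduced (definition-free file). -/

/-- Deletion and link sizes add up to the number of rows. -/
theorem delCard_add_linkCard (u : Fin r → Finset (Fin h)) (x : Fin h) :
    (Finset.univ.filter fun i => x ∉ u i).card + (Finset.univ.filter fun i => x ∈ u i).card = r := by
  have := Finset.card_filter_add_card_filter_not (s := (Finset.univ : Finset (Fin r))) (fun i => x ∉ u i)
  simp only [not_not, Finset.card_univ, Fintype.card_fin] at this
  exact this

/-- Double counting: summing the link sizes over a coordinate set containing every row gives the total size of the rows. -/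
theorem sum_linkCard (u : Fin r → Finset (Fin h)) (C : Finset (Fin h)) (hC : ∀ i, u i ⊆ C) :
    ∑ x ∈ C, (Finset.univ.filter fun i => x ∈ u i).card = ∑ i : Fin r, (u i).card := by
  classical
  simp_rw [Finset.card_filter]
  rw [Finset.sum_comm]
  refine Finset.sum_congr rfl fun i _ => ?_
  rw [← Finset.card_filter, Finset.filter_mem_eq_inter, Finset.inter_eq_right.mpr (hC i)]

/-- An injective family of `r` finsets has total size at least `r − 1` (at most one member is empty). -/
theorem pred_le_sum_card (u : Fin r → Finset (Fin h)) (hu : Function.Injective u) : r - 1 ≤ ∑ i : Fin r, (u i).card := by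
  classical
  set E : Finset (Fin r) := Finset.univ.filter fun i => u i = ∅ with hE
  have hE1 : E.card ≤ 1 := by
    refine Finset.card_le_one.mpr fun a ha b hb => ?_
    rw [hE, Finset.mem_filter] at ha hb
    exact hu (ha.2.trans hb.2.symm)
  have hsplit : E.card + (Finset.univ.filter fun i => ¬ u i = ∅).card = r := by
    have := Finset.card_filter_add_card_filter_not (s := (Finset.univ : Finset (Fin r))) (fun i => u i = ∅)
    simpa using this
  have hle : (Finset.univ.filter fun i => ¬ u i = ∅).card ≤ ∑ i : Fin r, (u i).card := by
    calc (Finset.univ.filter fun i => ¬ u i = ∅).card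
        = ∑ i ∈ Finset.univ.filter (fun i => ¬ u i = ∅), 1 := Finset.card_eq_sum_ones _
      _ ≤ ∑ i ∈ Finset.univ.filter (fun i => ¬ u i = ∅), (u i).card := by
          refine Finset.sum_le_sum fun i hi => ?_
          rw [Finset.mem_filter] at hi
          exact Finset.one_le_card.mpr (Finset.nonempty_iff_ne_empty.mpr hi.2)
      _ ≤ ∑ i : Fin r, (u i).card :=
          Finset.sum_le_sum_of_subset_of_nonneg (Finset.filter_subset _ _) fun _ _ _ => Nat.zero_le _
  omega

/-- **The link-size bound of the cut game** (`lam hd r = ⌊(r−2)/hd⌋ + 1 = ⌈(r−1)/hd⌉`): an injective family of `r ≥ 2` subsets of a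
coordinate set of size `≤ hd` has a coordinate lying in at least `⌈(r−1)/hd⌉` members. -/
theorem exists_link_ge (hd : ℕ) (u : Fin r → Finset (Fin h)) (C : Finset (Fin h)) (hCd : C.card ≤ hd)
    (hu : Function.Injective u) (hC : ∀ i, u i ⊆ C) (hr : 2 ≤ r) :
    ∃ x ∈ C, (r - 2) / hd + 1 ≤ (Finset.univ.filter fun i => x ∈ u i).card := by
  by_contra hno
  push Not at hno
  have hsum := sum_linkCard u C hC
  have hge := pred_le_sum_card u hu
  have hle : ∑ x ∈ C, (Finset.univ.filter fun i => x ∈ u i).card ≤ C.card * ((r - 2) / hd) := by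
    calc ∑ x ∈ C, (Finset.univ.filter fun i => x ∈ u i).card ≤ ∑ x ∈ C, (r - 2) / hd :=
          Finset.sum_le_sum fun x hx => Nat.le_of_lt_succ (hno x hx)
      _ = C.card * ((r - 2) / hd) := by rw [Finset.sum_const, smul_eq_mul]
  have hmul : C.card * ((r - 2) / hd) ≤ r - 2 :=
    le_trans (Nat.mul_le_mul_right _ hCd) (Nat.mul_div_le (r - 2) hd)
  omega

/-- **Link ⊆ deletion** for lower families: the link of any coordinate is at most as large as its deletion. -/
theorem linkCard_le_delCard (u : Fin r → Finset (Fin h)) (hu : Function.Injective u) (hlow : IsLowerSet (Set.range u))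
    (x : Fin h) : (Finset.univ.filter fun i => x ∈ u i).card ≤ (Finset.univ.filter fun i => x ∉ u i).card := by
  classical
  -- the map i ↦ (the index of (u i).erase x) sends rows containing x injectively to rows avoiding x
  have hex : ∀ i, x ∈ u i → ∃ i', u i' = (u i).erase x := by
    intro i hi
    have hmem : (u i).erase x ∈ Set.range u := hlow (Finset.erase_subset x (u i)) ⟨i, rfl⟩
    obtain ⟨i', hi'⟩ := hmem
    exact ⟨i', hi'⟩
  let φ : Fin r → Fin r := fun i => if hi : x ∈ u i then (hex i hi).choose else i
  refine Finset.card_le_card_of_injOn φ (fun i hi => ?_) ?_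
  · rw [Finset.mem_coe, Finset.mem_filter] at hi
    have hφ : u (φ i) = (u i).erase x := by
      simp only [φ, dif_pos hi.2]
      exact (hex i hi.2).choose_spec
    rw [Finset.mem_coe, Finset.mem_filter]
    exact ⟨Finset.mem_univ _, by rw [hφ]; exact Finset.notMem_erase x (u i)⟩
  · intro i hi j hj hij
    rw [Finset.mem_coe, Finset.mem_filter] at hi hj
    have hφi : u (φ i) = (u i).erase x := by
      simp only [φ, dif_pos hi.2]; exact (hex i hi.2).choose_spec
    have hφj : u (φ j) = (u j).erase x := by
      simp only [φ, dif_pos hj.2]; exact (hex j hj.2).choose_spec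
    apply hu
    rw [← Finset.insert_erase hi.2, ← Finset.insert_erase hj.2, ← hφi, ← hφj, hij]

/-- The rows avoiding `x` are distinct subsets of `C.erase x`, hence at most `2 ^ (C.erase x).card` of them. -/
theorem delCard_le_pow (u : Fin r → Finset (Fin h)) (hu : Function.Injective u) (C : Finset (Fin h)) (hC : ∀ i, u i ⊆ C)
    (x : Fin h) : (Finset.univ.filter fun i => x ∉ u i).card ≤ 2 ^ (C.erase x).card := by
  classical
  rw [← Finset.card_powerset]
  refine Finset.card_le_card_of_injOn u (fun i hi => ?_) fun i _ j _ hij => hu hij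
  rw [Finset.mem_coe, Finset.mem_filter] at hi
  rw [Finset.mem_coe, Finset.mem_powerset]
  intro a ha
  exact Finset.mem_erase.mpr ⟨fun hax => hi.2 (hax ▸ ha), hC i ha⟩

/-! ## 2. The cut game -/

/-- **THE u-OBLIVIOUS CUT GAME.** Let `W hd r e` be a predicate on COLUMN data (`e : Fin r → Fin m × Finset (Fin K)`, `hd` = number of
coordinates still available) and `lam` a link-size bound such that
* (`hlam`) every injective lower family of `r ≥ 2` rows inside `≤ hd` coordinates has a coordinate with link size `≥ lam hd r`;
* (`hwin`) every winning position with `r ≥ 2` answers every demand `r₀ + r₁ = r`, `lam hd r ≤ r₁ ≤ r₀ ≤ 2^(hd−1)` by cut constants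
  `β, γ` and a column enumeration `g₀ ⊔ g₁` (cut value `0` on `g₀`, nonzero on `g₁`) whose two sides are winning with `hd − 1` coordinates.
Then every winning position is generically good against EVERY injective lower row family on `≤ hd` coordinates. -/
theorem symGood_of_winning (W : (hd : ℕ) → (r : ℕ) → (Fin r → Fin m × Finset (Fin K)) → Prop) (lam : ℕ → ℕ → ℕ)
    (hlam : ∀ (hd r : ℕ) (u : Fin r → Finset (Fin h)) (C : Finset (Fin h)), C.card ≤ hd → Function.Injective u →
      IsLowerSet (Set.range u) → (∀ i, u i ⊆ C) → 2 ≤ r → ∃ x ∈ C, lam hd r ≤ (Finset.univ.filter fun i => x ∈ u i).card)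
    (hwin : ∀ (hd r : ℕ) (e : Fin r → Fin m × Finset (Fin K)), W hd r e → 2 ≤ r → 1 ≤ hd →
      ∀ r₀ r₁ : ℕ, r₀ + r₁ = r → lam hd r ≤ r₁ → r₁ ≤ r₀ → r₀ ≤ 2 ^ (hd - 1) →
        ∃ (β : Fin m → ℂ) (γ : Fin m → Fin K → ℂ) (g₀ : Fin r₀ → Fin r) (g₁ : Fin r₁ → Fin r),
          Function.Injective (Sum.elim g₀ g₁) ∧ (∀ j, xi e β γ (g₀ j) = 0) ∧ (∀ j, xi e β γ (g₁ j) ≠ 0) ∧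
          W (hd - 1) r₀ (fun j => e (g₀ j)) ∧ W (hd - 1) r₁ (fun j => e (g₁ j))) :
    ∀ (hd r : ℕ) (u : Fin r → Finset (Fin h)) (C : Finset (Fin h)) (e : Fin r → Fin m × Finset (Fin K)),
      C.card ≤ hd → Function.Injective u → IsLowerSet (Set.range u) → (∀ i, u i ⊆ C) → W hd r e →
      symDet u e ≠ 0 := by
  classical
  -- base case shared by both steps: at most one row
  have base : ∀ (r : ℕ) (u : Fin r → Finset (Fin h)) (e : Fin r → Fin m × Finset (Fin K)),
      r ≤ 1 → Function.Injective u → symDet u e ≠ 0 := by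
    intro r u e hr hu
    rcases Nat.lt_or_ge r 1 with h0 | h1
    · have hr0 : r = 0 := by omega
      subst hr0
      unfold symDet
      rw [Matrix.det_isEmpty]
      exact one_ne_zero
    · have hr1 : r = 1 := le_antisymm hr h1
      subst hr1
      exact symGood_of_lonely u hu e fun a b _ => Subsingleton.elim a b
  intro hd
  induction hd with
  | zero =>
    intro r u C e hC hu _ hsub _
    -- no coordinates: every row is empty, so r ≤ 1
    have hCe : C = ∅ := Finset.card_eq_zero.mp (Nat.le_zero.mp hC)
    have hr : r ≤ 1 := by
      by_contra hr
      have h01 : (⟨0, by omega⟩ : Fin r) ≠ ⟨1, by omega⟩ := by simp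
      apply h01
      apply hu
      have h0 : u ⟨0, by omega⟩ = ∅ := Finset.subset_empty.mp (hCe ▸ hsub _)
      have h1 : u ⟨1, by omega⟩ = ∅ := Finset.subset_empty.mp (hCe ▸ hsub _)
      rw [h0, h1]
    exact base r u e hr hu
  | succ hd ih =>
    intro r u C e hC hu hlow hsub hW
    rcases Nat.lt_or_ge r 2 with hr | hr
    · exact base r u e (by omega) hu
    -- choose the coordinate with the largest certified link
    obtain ⟨x, hxC, hxlam⟩ := hlam (hd + 1) r u C hC hu hlow hsub hr
    set r₁ := (Finset.univ.filter fun i => x ∈ u i).card with hr₁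
    set r₀ := (Finset.univ.filter fun i => x ∉ u i).card with hr₀
    have hsum : r₀ + r₁ = r := delCard_add_linkCard u x
    have h10 : r₁ ≤ r₀ := linkCard_le_delCard u hu hlow x
    have hpow : r₀ ≤ 2 ^ (hd + 1 - 1) := by
      refine (delCard_le_pow u hu C hsub x).trans ?_
      rw [Finset.card_erase_of_mem hxC]
      exact Nat.pow_le_pow_right (by norm_num) (by omega)
    obtain ⟨β, γ, g₀, g₁, hg, hcol0, hcol1, hW0, hW1⟩ :=
      hwin (hd + 1) r e hW hr (by omega) r₀ r₁ hsum hxlam h10 hpow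
    simp only [Nat.add_sub_cancel] at hW0 hW1
    -- enumerate the rows avoiding / containing x
    set S₀ : Finset (Fin r) := Finset.univ.filter fun i => x ∉ u i with hS₀
    set S₁ : Finset (Fin r) := Finset.univ.filter fun i => x ∈ u i with hS₁
    have hc₀ : S₀.card = r₀ := rfl
    have hc₁ : S₁.card = r₁ := rfl
    let f₀ : Fin r₀ → Fin r := fun j => (S₀.equivFin.symm (j.cast hc₀.symm)).1
    let f₁ : Fin r₁ → Fin r := fun j => (S₁.equivFin.symm (j.cast hc₁.symm)).1
    have hf₀m : ∀ j, f₀ j ∈ S₀ := fun j => (S₀.equivFin.symm (j.cast hc₀.symm)).2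
    have hf₁m : ∀ j, f₁ j ∈ S₁ := fun j => (S₁.equivFin.symm (j.cast hc₁.symm)).2
    have hrow0 : ∀ j, x ∉ u (f₀ j) := fun j => by
      have := hf₀m j; rw [hS₀, Finset.mem_filter] at this; exact this.2
    have hrow1 : ∀ j, x ∈ u (f₁ j) := fun j => by
      have := hf₁m j; rw [hS₁, Finset.mem_filter] at this; exact this.2
    have hf₀i : Function.Injective f₀ := by
      intro a b hab
      have := S₀.equivFin.symm.injective (Subtype.ext hab)
      exact Fin.cast_injective _ this
    have hf₁i : Function.Injective f₁ := by
      intro a b hab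
      have := S₁.equivFin.symm.injective (Subtype.ext hab)
      exact Fin.cast_injective _ this
    have hf : Function.Injective (Sum.elim f₀ f₁) := by
      rintro (a | a) (b | b) hab
      · exact congrArg Sum.inl (hf₀i hab)
      · exact absurd (hrow1 b) (by simp only [Sum.elim_inl, Sum.elim_inr] at hab; rw [← hab]; exact hrow0 a)
      · exact absurd (hrow1 a) (by simp only [Sum.elim_inl, Sum.elim_inr] at hab; rw [hab]; exact hrow0 b)
      · exact congrArg Sum.inr (hf₁i hab)
    -- the two sub-configurations are lower families on C.erase x
    have hCx : (C.erase x).card ≤ hd := by rw [Finset.card_erase_of_mem hxC]; omega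
    have hu0 : Function.Injective fun j : Fin r₀ => u (f₀ j) := fun a b hab => hf₀i (hu hab)
    have hu1 : Function.Injective fun j : Fin r₁ => (u (f₁ j)).erase x := by
      intro a b hab
      apply hf₁i; apply hu
      have := congrArg (insert x) hab
      simp only [Finset.insert_erase (hrow1 a), Finset.insert_erase (hrow1 b)] at this
      exact this
    have hsub0 : ∀ j, u (f₀ j) ⊆ C.erase x := fun j a ha =>
      Finset.mem_erase.mpr ⟨fun hax => hrow0 j (hax ▸ ha), hsub _ ha⟩
    have hsub1 : ∀ j, (u (f₁ j)).erase x ⊆ C.erase x := fun j =>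
      Finset.erase_subset_erase x (hsub _)
    have hlow0 : IsLowerSet (Set.range fun j : Fin r₀ => u (f₀ j)) := by
      intro A B hBA hA
      obtain ⟨j, rfl⟩ := hA
      obtain ⟨i, hi⟩ : B ∈ Set.range u := hlow hBA ⟨f₀ j, rfl⟩
      have hxi : x ∉ u i := fun hx => hrow0 j (hBA (hi ▸ hx))
      have hiS : i ∈ S₀ := by rw [hS₀, Finset.mem_filter]; exact ⟨Finset.mem_univ _, hxi⟩
      refine ⟨(S₀.equivFin ⟨i, hiS⟩).cast hc₀, ?_⟩
      simp only [f₀, Fin.cast_eq_self, Equiv.symm_apply_apply]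
      exact hi
    have hlow1 : IsLowerSet (Set.range fun j : Fin r₁ => (u (f₁ j)).erase x) := by
      intro A B hBA hA
      obtain ⟨j, rfl⟩ := hA
      have hxB : x ∉ B := fun hx => Finset.notMem_erase x (u (f₁ j)) (hBA hx)
      have hBx : insert x B ⊆ u (f₁ j) := by
        intro a ha
        rcases Finset.mem_insert.mp ha with rfl | ha
        · exact hrow1 j
        · exact Finset.mem_of_mem_erase (hBA ha)
      obtain ⟨i, hi⟩ : insert x B ∈ Set.range u := hlow hBx ⟨f₁ j, rfl⟩
      have hxi : x ∈ u i := by rw [hi]; exact Finset.mem_insert_self x B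
      have hiS : i ∈ S₁ := by rw [hS₁, Finset.mem_filter]; exact ⟨Finset.mem_univ _, hxi⟩
      refine ⟨(S₁.equivFin ⟨i, hiS⟩).cast hc₁, ?_⟩
      simp only [f₁, Fin.cast_eq_self, Equiv.symm_apply_apply]
      rw [hi, Finset.erase_insert hxB]
    -- induction hypothesis on both sides, then the symbolic split theorem
    have h0 : symDet (fun j : Fin r₀ => u (f₀ j)) (fun j => e (g₀ j)) ≠ 0 :=
      ih r₀ (fun j => u (f₀ j)) (C.erase x) (fun j => e (g₀ j)) hCx hu0 hlow0 hsub0 hW0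
    have h1 : symDet (fun j : Fin r₁ => (u (f₁ j)).erase x) (fun j => e (g₁ j)) ≠ 0 :=
      ih r₁ (fun j => (u (f₁ j)).erase x) (C.erase x) (fun j => e (g₁ j)) hCx hu1 hlow1 hsub1 hW1
    exact symGood_of_split_enum u e x β γ hsum f₀ f₁ g₀ g₁ hf hg hrow0 hrow1 hcol0 hcol1 h0 h1

/-- **The cut game with the certified bound `⌈(r−1)/hd⌉`, in the line's `∃ table` language.** If `W` wins the cut game against the
demands `r₀ + r₁ = r`, `⌊(r−2)/hd⌋ + 1 ≤ r₁ ≤ r₀ ≤ 2^(hd−1)`, then every winning position `e` with `h` coordinates has, for EVERY injective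
LOWER row family `u : Fin r → Finset (Fin h)`, a table making the block-additive matrix nonsingular. -/
theorem exists_table_of_winning (W : (hd : ℕ) → (r : ℕ) → (Fin r → Fin m × Finset (Fin K)) → Prop)
    (hwin : ∀ (hd r : ℕ) (e : Fin r → Fin m × Finset (Fin K)), W hd r e → 2 ≤ r → 1 ≤ hd →
      ∀ r₀ r₁ : ℕ, r₀ + r₁ = r → (r - 2) / hd + 1 ≤ r₁ → r₁ ≤ r₀ → r₀ ≤ 2 ^ (hd - 1) →
        ∃ (β : Fin m → ℂ) (γ : Fin m → Fin K → ℂ) (g₀ : Fin r₀ → Fin r) (g₁ : Fin r₁ → Fin r),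
          Function.Injective (Sum.elim g₀ g₁) ∧ (∀ j, xi e β γ (g₀ j) = 0) ∧ (∀ j, xi e β γ (g₁ j) ≠ 0) ∧
          W (hd - 1) r₀ (fun j => e (g₀ j)) ∧ W (hd - 1) r₁ (fun j => e (g₁ j)))
    (e : Fin r → Fin m × Finset (Fin K)) (hW : W h r e)
    (u : Fin r → Finset (Fin h)) (hu : Function.Injective u) (hlow : IsLowerSet (Set.range u)) :
    ∃ tx : Fin m → Option (Fin K) → Fin h → ℂ,
      (Matrix.of fun i k : Fin r =>
        ∏ a ∈ u i, (tx (e k).1 none a + ∑ q ∈ (e k).2, tx (e k).1 (some q) a)).det ≠ 0 := by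
  refine exists_table_of_symGood u e ?_
  refine symGood_of_winning W (fun hd r => (r - 2) / hd + 1)
    (fun hd r u C hCd hu _ hC hr => exists_link_ge hd u C hCd hu hC hr) hwin h r u Finset.univ e ?_ hu hlow
    (fun i => Finset.subset_univ _) hW
  rw [Finset.card_univ, Fintype.card_fin]

end SymbJoin

end

end Summit.ValiantsHypothesis.ValiantsHypothesis.Theorems.BarrierLever.HiddenStates
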